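import Summits.MatrixMultiplication.OmegaCensus.SmallFormats.RankOnePlaneCapGaugeHeads
import HarnessLib

/-!
# ω-census family (a): the POSITION normal form of the gauge — two 2-planes in `k⁵` are 'same',
'line' or 'zero' up to an invertible change of coordinates

Cell `pub-omega` (unit `pub-omega-tensor`, gen 29), topic `Summits/MatrixMultiplication/OmegaCensus`
(sub-folder `SmallFormats`). Framing (verbatim): lottery ticket; floor = certified bounds/negative
ranges. HONEST FRAMING: the last desk step of the v1.2 gauge of the gauge-SAT instrument of the `𝔽₃`
`⟨2,2,5⟩@17` X-marginal census (tensor-g28 kitjob-gs README §gauge (1)–(2)) as a tree theorem; pure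
linear algebra over any field. Not a bound on any rank, not progress on `ω`.

* `exists_gauge_pair_fin5`: for 2-dimensional `U₁, U₂ ≤ k⁵` there are `A A' = A' A = 1` such that
  `x ↦ x A'` maps `U₁` into `⟨e₀,e₁⟩` and `U₂` into `⟨e₀,e₁⟩` ('same'), `⟨e₀,e₂⟩` ('line') or
  `⟨e₂,e₃⟩` ('zero') — an adapted basis (`U₁ = U₂`; `dim U₁ ∩ U₂ = 1`: `l, u, u'`; `U₁ ∩ U₂ = 0`:
  `u₀..u₃`) extended to a basis of `k⁵`, `A'` its coordinate map.
* `exists_dotOrthogonal_fin5`: `dim E = 3 ⇒ dim E^⊥ = 2` (the `F′ = E^⊥` of a saturated column plane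
  at `(n,r) = (5,17)`, `card_vanishing_col_eq_two_mul_sub`).
* `exists_gauge_normal_form_225`: applied with `exists_colTransform` (`W_i ↦ W_i A'`,
  `g_i ↦ g_i(· A)`, X-forms UNCHANGED) to a computation of `⟨2,2,5⟩` whose `R₁`-outputs kill a
  3-space `E₁` and `R₂`-outputs kill `E₂`: WLOG the `R₁`-outputs are supported on columns `0,1`
  (`F′₁ = ⟨e₀,e₁⟩`) and the `R₂`-outputs on columns `0,1` / `0,2` / `2,3` — the encoder's positions.
-/

namespace Summit.MatrixMultiplication.OmegaCensus.RankOnePlaneCapGeneral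

open Module Matrix Literature.Computability.AlgebraicComplexity

variable {k : Type*} [Field k]

/-- A linearly independent family of fewer than five vectors of `k⁵` misses some vector in its span. -/
theorem exists_not_mem_span_fin5 {j : ℕ} (hj : j < 5) {v : Fin j → Fin 5 → k}
    (hv : LinearIndependent k v) : ∃ x : Fin 5 → k, x ∉ Submodule.span k (Set.range v) := by
  by_contra h
  push Not at h
  have htop : Submodule.span k (Set.range v) = ⊤ := Submodule.eq_top_iff'.mpr h
  have h1 : finrank k (Submodule.span k (Set.range v)) = j := by
    rw [finrank_span_eq_card hv, Fintype.card_fin]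
  rw [htop, finrank_top, Module.finrank_fin_fun] at h1
  omega

/-- A 2-dimensional subspace of `k⁵` has two independent vectors spanning it. -/
theorem exists_pair_of_finrank_eq_two (U : Submodule k (Fin 5 → k)) (hU : finrank k U = 2) :
    ∃ u₀ u₁ : Fin 5 → k, u₀ ∈ U ∧ u₁ ∈ U ∧ LinearIndependent k ![u₀, u₁] ∧
      ∀ x ∈ U, ∃ a b : k, a • u₀ + b • u₁ = x := by
  let bU := Module.finBasisOfFinrankEq k U hU
  refine ⟨bU 0, bU 1, (bU 0).2, (bU 1).2, ?_, fun x hx => ?_⟩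
  · have hli := bU.linearIndependent.map' U.subtype U.ker_subtype
    have : (U.subtype ∘ bU : Fin 2 → Fin 5 → k) = ![((bU 0 : U) : Fin 5 → k), (bU 1 : U)] := by
      funext i; fin_cases i <;> rfl
    rw [← this]; exact hli
  · refine ⟨bU.repr ⟨x, hx⟩ 0, bU.repr ⟨x, hx⟩ 1, ?_⟩
    have h := bU.sum_repr ⟨x, hx⟩
    rw [Fin.sum_univ_two] at h
    have h' := congrArg Subtype.val h
    simpa using h'

/-- The line case: `U₁ ≠ U₂` meeting in a line have vectors `l, u, u'` with `U₁ ∋ l, u`, `U₂ ∋ l, u'`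
and `![u', u, l]` linearly independent, `U₁ = {a u + b l}`, `U₂ = {a u' + b l}`. -/
theorem exists_triple_of_finrank_inf_eq_one (U₁ U₂ : Submodule k (Fin 5 → k))
    (h₁ : finrank k U₁ = 2) (h₂ : finrank k U₂ = 2) (h12 : finrank k ↥(U₁ ⊓ U₂) = 1) :
    ∃ l u u' : Fin 5 → k, l ∈ U₁ ∧ l ∈ U₂ ∧ u ∈ U₁ ∧ u' ∈ U₂ ∧
      LinearIndependent k ![u', u, l] ∧
      (∀ x ∈ U₁, ∃ a b : k, a • u + b • l = x) ∧ (∀ x ∈ U₂, ∃ a b : k, a • u' + b • l = x) := by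
  -- a nonzero vector on the common line
  have hne : U₁ ⊓ U₂ ≠ ⊥ := by intro h; rw [← Submodule.finrank_eq_zero] at h; omega
  obtain ⟨l, hl, hl0⟩ := Submodule.exists_mem_ne_zero_of_ne_bot hne
  have hline : U₁ ⊓ U₂ = Submodule.span k {l} := by
    symm
    apply Submodule.eq_of_le_of_finrank_eq
    · rw [Submodule.span_singleton_le_iff_mem]; exact hl
    · rw [finrank_span_singleton hl0, h12]
  -- vectors of `U₁`, `U₂` off the line
  have hoff : ∀ U : Submodule k (Fin 5 → k), finrank k U = 2 → l ∈ U →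
      ∃ u ∈ U, u ∉ Submodule.span k {l} := by
    intro U hU hlU
    by_contra h
    push Not at h
    have := Submodule.finrank_mono (show U ≤ Submodule.span k {l} from h)
    rw [finrank_span_singleton hl0, hU] at this
    omega
  obtain ⟨u, hu, hul⟩ := hoff U₁ h₁ (Submodule.mem_inf.mp hl).1
  obtain ⟨u', hu', hu'l⟩ := hoff U₂ h₂ (Submodule.mem_inf.mp hl).2
  have hl₁ : l ∈ U₁ := (Submodule.mem_inf.mp hl).1
  have hl₂ : l ∈ U₂ := (Submodule.mem_inf.mp hl).2
  -- `![w, l]` (`w ∈ U` off the line) is independent and spans `U`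
  have hpair : ∀ (U : Submodule k (Fin 5 → k)) (w : Fin 5 → k), finrank k U = 2 → l ∈ U → w ∈ U →
      w ∉ Submodule.span k {l} → LinearIndependent k ![w, l] ∧
        ∀ x ∈ U, ∃ a b : k, a • w + b • l = x := by
    intro U w hU hlU hw hwl
    have hli : LinearIndependent k ![w, l] := by
      rw [linearIndependent_fin2]
      refine ⟨hl0, fun a ha => hwl ?_⟩
      rw [Submodule.mem_span_singleton]
      exact ⟨a, ha⟩
    have hspan : Submodule.span k (Set.range ![w, l]) = U := by
      refine Submodule.eq_of_le_of_finrank_eq ?_ ?_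
      · rw [Submodule.span_le, Set.range_subset_iff]
        intro i; fin_cases i <;> simp [hw, hlU]
      · rw [finrank_span_eq_card hli, Fintype.card_fin, hU]
    refine ⟨hli, fun x hx => ?_⟩
    rw [← hspan, Submodule.mem_span_range_iff_exists_fun] at hx
    obtain ⟨c, hc⟩ := hx
    refine ⟨c 0, c 1, ?_⟩
    rw [Fin.sum_univ_two] at hc
    simpa using hc
  obtain ⟨hli₁, hsp₁⟩ := hpair U₁ u h₁ hl₁ hu hul
  obtain ⟨hli₂, hsp₂⟩ := hpair U₂ u' h₂ hl₂ hu' hu'l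
  refine ⟨l, u, u', hl₁, hl₂, hu, hu', ?_, hsp₁, hsp₂⟩
  -- `u' ∉ U₁ ⊇ span {u, l}`
  have hu'U₁ : u' ∉ U₁ := by
    intro h
    apply hu'l
    rw [← hline]
    exact Submodule.mem_inf.mpr ⟨h, hu'⟩
  refine LinearIndependent.finCons (x := u') (v := ![u, l]) hli₁ fun h => hu'U₁ ?_
  refine (Submodule.span_le.mpr ?_ : Submodule.span k (Set.range ![u, l]) ≤ U₁) h
  rw [Set.range_subset_iff]
  intro i; fin_cases i <;> simp [hu, hl₁]

/-- The zero case: `U₁ ∩ U₂ = 0` gives `![u₃, u₂, u₁, u₀]` linearly independent with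
`U₁ = {a u₀ + b u₁}`, `U₂ = {a u₂ + b u₃}`. -/
theorem exists_quad_of_inf_eq_bot (U₁ U₂ : Submodule k (Fin 5 → k))
    (h₁ : finrank k U₁ = 2) (h₂ : finrank k U₂ = 2) (h12 : U₁ ⊓ U₂ = ⊥) :
    ∃ u₀ u₁ u₂ u₃ : Fin 5 → k, LinearIndependent k ![u₃, u₂, u₁, u₀] ∧
      (∀ x ∈ U₁, ∃ a b : k, a • u₀ + b • u₁ = x) ∧ (∀ x ∈ U₂, ∃ a b : k, a • u₂ + b • u₃ = x) := by
  obtain ⟨u₀, u₁, hu₀, hu₁, hli₁, hsp₁⟩ := exists_pair_of_finrank_eq_two U₁ h₁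
  obtain ⟨u₂, u₃, hu₂, hu₃, hli₂, hsp₂⟩ := exists_pair_of_finrank_eq_two U₂ h₂
  refine ⟨u₀, u₁, u₂, u₃, ?_, hsp₁, hsp₂⟩
  -- `![u₁, u₀]` independent (swap of `![u₀, u₁]`)
  have hli₁' : LinearIndependent k ![u₁, u₀] := by
    rw [LinearIndependent.pair_iff] at hli₁ ⊢
    intro s t hst
    have := hli₁ t s (by rw [add_comm]; exact hst)
    exact ⟨this.2, this.1⟩
  have hspanU₁ : Submodule.span k (Set.range ![u₁, u₀]) ≤ U₁ := by
    rw [Submodule.span_le, Set.range_subset_iff]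
    intro i; fin_cases i <;> simp [hu₀, hu₁]
  -- `u₂ ∉ U₁`
  have hu₂0 : u₂ ≠ 0 := by
    intro h
    have := (LinearIndependent.pair_iff.mp hli₂) 1 0 (by rw [h]; simp)
    exact one_ne_zero this.1
  have hu₂U₁ : u₂ ∉ U₁ := by
    intro h
    have : u₂ ∈ U₁ ⊓ U₂ := Submodule.mem_inf.mpr ⟨h, hu₂⟩
    rw [h12, Submodule.mem_bot] at this
    exact hu₂0 this
  have hli3 : LinearIndependent k ![u₂, u₁, u₀] :=
    LinearIndependent.finCons (x := u₂) (v := ![u₁, u₀]) hli₁' fun h => hu₂U₁ (hspanU₁ h)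
  -- `u₃ ∉ span {u₂, u₁, u₀}`
  refine LinearIndependent.finCons (x := u₃) (v := ![u₂, u₁, u₀]) hli3 fun h => ?_
  have hle : Submodule.span k (Set.range ![u₂, u₁, u₀]) ≤ Submodule.span k {u₂} ⊔ U₁ := by
    rw [Submodule.span_le, Set.range_subset_iff]
    intro i
    fin_cases i
    · exact Submodule.mem_sup_left (Submodule.mem_span_singleton_self u₂)
    · exact Submodule.mem_sup_right hu₁
    · exact Submodule.mem_sup_right hu₀
  obtain ⟨y, hy, z, hz, hyz⟩ := Submodule.mem_sup.mp (hle h)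
  obtain ⟨a, rfl⟩ := Submodule.mem_span_singleton.mp hy
  have hzU₂ : z ∈ U₂ := by
    have : z = u₃ - a • u₂ := by rw [← hyz]; abel
    rw [this]
    exact U₂.sub_mem hu₃ (U₂.smul_mem a hu₂)
  have hz0 : z = 0 := by
    have : z ∈ U₁ ⊓ U₂ := Submodule.mem_inf.mpr ⟨hz, hzU₂⟩
    rwa [h12, Submodule.mem_bot] at this
  rw [hz0, add_zero] at hyz
  -- `u₃ = a • u₂` contradicts the independence of `![u₂, u₃]`
  have := (LinearIndependent.pair_iff.mp hli₂) a (-1) (by rw [hyz]; simp)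
  exact one_ne_zero (neg_eq_zero.mp this.2)

/-- The coordinate matrices of a basis `b` of `k⁵`: `A'` (rows `x ↦ x A'` = coordinates of `x`) and
its inverse `A`; a combination of `b i`, `b i'` has vanishing coordinates off `{i, i'}`. -/
theorem exists_coordMatrices (b : Basis (Fin 5) k (Fin 5 → k)) :
    ∃ A A' : Matrix (Fin 5) (Fin 5) k, A * A' = 1 ∧ A' * A = 1 ∧
      ∀ (i i' : Fin 5) (a c : k) (j : Fin 5), j ≠ i → j ≠ i' →
        ((a • b i + c • b i') ᵥ* A') j = 0 := by
  classical
  let e : (Fin 5 → k) ≃ₗ[k] (Fin 5 → k) := b.equivFun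
  refine ⟨(LinearMap.toMatrix' (e.symm : (Fin 5 → k) →ₗ[k] (Fin 5 → k)))ᵀ,
    (LinearMap.toMatrix' (e : (Fin 5 → k) →ₗ[k] (Fin 5 → k)))ᵀ, ?_, ?_, ?_⟩
  · rw [← Matrix.transpose_mul, ← LinearMap.toMatrix'_comp, LinearEquiv.comp_symm,
      LinearMap.toMatrix'_id, Matrix.transpose_one]
  · rw [← Matrix.transpose_mul, ← LinearMap.toMatrix'_comp, LinearEquiv.symm_comp,
      LinearMap.toMatrix'_id, Matrix.transpose_one]
  · intro i i' a c j hj hj'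
    rw [Matrix.vecMul_transpose, LinearMap.toMatrix'_mulVec]
    simp [e, Basis.equivFun_apply, hj, hj']

/-- **Position normal form of two 2-planes in `k⁵`.** For 2-dimensional `U₁, U₂ ≤ k⁵` there are
`A A' = A' A = 1` such that `x ↦ x A'` sends `U₁` into `⟨e₀,e₁⟩` and `U₂` into `⟨e₀,e₁⟩` ('same'),
`⟨e₀,e₂⟩` ('line') or `⟨e₂,e₃⟩` ('zero') (membership written as the vanishing of the other three
coordinates). -/
theorem exists_gauge_pair_fin5 (U₁ U₂ : Submodule k (Fin 5 → k))
    (h₁ : finrank k U₁ = 2) (h₂ : finrank k U₂ = 2) :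
    ∃ A A' : Matrix (Fin 5) (Fin 5) k, A * A' = 1 ∧ A' * A = 1 ∧
      (∀ x ∈ U₁, (x ᵥ* A') 2 = 0 ∧ (x ᵥ* A') 3 = 0 ∧ (x ᵥ* A') 4 = 0) ∧
      ((∀ x ∈ U₂, (x ᵥ* A') 2 = 0 ∧ (x ᵥ* A') 3 = 0 ∧ (x ᵥ* A') 4 = 0) ∨
       (∀ x ∈ U₂, (x ᵥ* A') 1 = 0 ∧ (x ᵥ* A') 3 = 0 ∧ (x ᵥ* A') 4 = 0) ∨
       (∀ x ∈ U₂, (x ᵥ* A') 0 = 0 ∧ (x ᵥ* A') 1 = 0 ∧ (x ᵥ* A') 4 = 0)) := by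
  classical
  have hcard : Fintype.card (Fin 5) = finrank k (Fin 5 → k) := by simp
  -- the dimension of the intersection decides the case
  have hd : finrank k ↥(U₁ ⊓ U₂) ≤ 2 := h₁ ▸ Submodule.finrank_mono inf_le_left
  rcases Nat.lt_or_ge (finrank k ↥(U₁ ⊓ U₂)) 1 with hd0 | hd1
  · -- ZERO: `U₁ ⊓ U₂ = ⊥`
    have h12 : U₁ ⊓ U₂ = ⊥ := by rw [← Submodule.finrank_eq_zero]; omega
    obtain ⟨u₀, u₁, u₂, u₃, hli4, hsp₁, hsp₂⟩ := exists_quad_of_inf_eq_bot U₁ U₂ h₁ h₂ h12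
    obtain ⟨x, hx⟩ := exists_not_mem_span_fin5 (by norm_num) hli4
    have hli5 : LinearIndependent k ![x, u₃, u₂, u₁, u₀] :=
      LinearIndependent.finCons (x := x) (v := ![u₃, u₂, u₁, u₀]) hli4 hx
    let b := basisOfLinearIndependentOfCardEqFinrank hli5 hcard
    have hb : ⇑b = ![x, u₃, u₂, u₁, u₀] := coe_basisOfLinearIndependentOfCardEqFinrank hli5 hcard
    let b' := b.reindex Fin.revPerm
    have hb' : ∀ i, b' i = ![x, u₃, u₂, u₁, u₀] (Fin.rev i) := fun i => by
      rw [Basis.reindex_apply, Fin.revPerm_symm, Fin.revPerm_apply, hb]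
    obtain ⟨A, A', hAA', hA'A, hcoord⟩ := exists_coordMatrices b'
    refine ⟨A, A', hAA', hA'A, fun y hy => ?_, Or.inr (Or.inr fun y hy => ?_)⟩
    · obtain ⟨a, c, rfl⟩ := hsp₁ y hy
      have h0 : u₀ = b' 0 := by rw [hb']; rfl
      have h1 : u₁ = b' 1 := by rw [hb']; rfl
      rw [h0, h1]
      exact ⟨hcoord 0 1 a c 2 (by decide) (by decide), hcoord 0 1 a c 3 (by decide) (by decide),
        hcoord 0 1 a c 4 (by decide) (by decide)⟩
    · obtain ⟨a, c, rfl⟩ := hsp₂ y hy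
      have h2 : u₂ = b' 2 := by rw [hb']; rfl
      have h3 : u₃ = b' 3 := by rw [hb']; rfl
      rw [h2, h3]
      exact ⟨hcoord 2 3 a c 0 (by decide) (by decide), hcoord 2 3 a c 1 (by decide) (by decide),
        hcoord 2 3 a c 4 (by decide) (by decide)⟩
  rcases Nat.lt_or_ge (finrank k ↥(U₁ ⊓ U₂)) 2 with hd1' | hd2
  · -- LINE: `dim (U₁ ⊓ U₂) = 1`
    have h12 : finrank k ↥(U₁ ⊓ U₂) = 1 := by omega
    obtain ⟨l, u, u', hl₁, hl₂, hu, hu', hli3, hsp₁, hsp₂⟩ :=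
      exists_triple_of_finrank_inf_eq_one U₁ U₂ h₁ h₂ h12
    obtain ⟨x', hx'⟩ := exists_not_mem_span_fin5 (by norm_num) hli3
    have hli4 : LinearIndependent k ![x', u', u, l] :=
      LinearIndependent.finCons (x := x') (v := ![u', u, l]) hli3 hx'
    obtain ⟨x, hx⟩ := exists_not_mem_span_fin5 (by norm_num) hli4
    have hli5 : LinearIndependent k ![x, x', u', u, l] :=
      LinearIndependent.finCons (x := x) (v := ![x', u', u, l]) hli4 hx
    let b := basisOfLinearIndependentOfCardEqFinrank hli5 hcard
    have hb : ⇑b = ![x, x', u', u, l] := coe_basisOfLinearIndependentOfCardEqFinrank hli5 hcard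
    let b' := b.reindex Fin.revPerm
    have hb' : ∀ i, b' i = ![x, x', u', u, l] (Fin.rev i) := fun i => by
      rw [Basis.reindex_apply, Fin.revPerm_symm, Fin.revPerm_apply, hb]
    obtain ⟨A, A', hAA', hA'A, hcoord⟩ := exists_coordMatrices b'
    have h0 : l = b' 0 := by rw [hb']; rfl
    have h1 : u = b' 1 := by rw [hb']; rfl
    have h2 : u' = b' 2 := by rw [hb']; rfl
    refine ⟨A, A', hAA', hA'A, fun y hy => ?_, Or.inr (Or.inl fun y hy => ?_)⟩
    · obtain ⟨a, c, rfl⟩ := hsp₁ y hy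
      rw [h0, h1]
      exact ⟨hcoord 1 0 a c 2 (by decide) (by decide), hcoord 1 0 a c 3 (by decide) (by decide),
        hcoord 1 0 a c 4 (by decide) (by decide)⟩
    · obtain ⟨a, c, rfl⟩ := hsp₂ y hy
      rw [h0, h2]
      exact ⟨hcoord 2 0 a c 1 (by decide) (by decide), hcoord 2 0 a c 3 (by decide) (by decide),
        hcoord 2 0 a c 4 (by decide) (by decide)⟩
  · -- SAME: `U₁ = U₂`
    have hinf₁ : U₁ ⊓ U₂ = U₁ :=
      Submodule.eq_of_le_of_finrank_eq inf_le_left (by omega)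
    have hU : U₂ = U₁ := by
      have hle : U₁ ≤ U₂ := by rw [← hinf₁]; exact inf_le_right
      exact (Submodule.eq_of_le_of_finrank_eq hle (by rw [h₁, h₂])).symm
    obtain ⟨u₀, u₁, hu₀, hu₁, hli2, hsp⟩ := exists_pair_of_finrank_eq_two U₁ h₁
    have hli2' : LinearIndependent k ![u₁, u₀] := by
      rw [LinearIndependent.pair_iff] at hli2 ⊢
      intro s t hst
      have := hli2 t s (by rw [add_comm]; exact hst)
      exact ⟨this.2, this.1⟩
    obtain ⟨x₂, hx₂⟩ := exists_not_mem_span_fin5 (by norm_num) hli2'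
    have hli3 : LinearIndependent k ![x₂, u₁, u₀] :=
      LinearIndependent.finCons (x := x₂) (v := ![u₁, u₀]) hli2' hx₂
    obtain ⟨x₁, hx₁⟩ := exists_not_mem_span_fin5 (by norm_num) hli3
    have hli4 : LinearIndependent k ![x₁, x₂, u₁, u₀] :=
      LinearIndependent.finCons (x := x₁) (v := ![x₂, u₁, u₀]) hli3 hx₁
    obtain ⟨x₀, hx₀⟩ := exists_not_mem_span_fin5 (by norm_num) hli4
    have hli5 : LinearIndependent k ![x₀, x₁, x₂, u₁, u₀] :=
      LinearIndependent.finCons (x := x₀) (v := ![x₁, x₂, u₁, u₀]) hli4 hx₀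
    let b := basisOfLinearIndependentOfCardEqFinrank hli5 hcard
    have hb : ⇑b = ![x₀, x₁, x₂, u₁, u₀] := coe_basisOfLinearIndependentOfCardEqFinrank hli5 hcard
    let b' := b.reindex Fin.revPerm
    have hb' : ∀ i, b' i = ![x₀, x₁, x₂, u₁, u₀] (Fin.rev i) := fun i => by
      rw [Basis.reindex_apply, Fin.revPerm_symm, Fin.revPerm_apply, hb]
    obtain ⟨A, A', hAA', hA'A, hcoord⟩ := exists_coordMatrices b'
    have h0 : u₀ = b' 0 := by rw [hb']; rfl
    have h1 : u₁ = b' 1 := by rw [hb']; rfl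
    have hboth : ∀ y ∈ U₁, (y ᵥ* A') 2 = 0 ∧ (y ᵥ* A') 3 = 0 ∧ (y ᵥ* A') 4 = 0 := by
      intro y hy
      obtain ⟨a, c, rfl⟩ := hsp y hy
      rw [h0, h1]
      exact ⟨hcoord 0 1 a c 2 (by decide) (by decide), hcoord 0 1 a c 3 (by decide) (by decide),
        hcoord 0 1 a c 4 (by decide) (by decide)⟩
    exact ⟨A, A', hAA', hA'A, hboth, Or.inl (hU ▸ hboth)⟩

/-- For a 3-dimensional `E ≤ k⁵`, the dot-orthogonal `E^⊥ = {x : x · e = 0 ∀ e ∈ E}` is a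
2-dimensional subspace (the `F′ = E^⊥`, `dim F′ = r − 3n = 2`, of a saturated column plane at
`(n,r) = (5,17)`). -/
theorem exists_dotOrthogonal_fin5 (E : Submodule k (Fin 5 → k)) (hE : finrank k E = 3) :
    ∃ F : Submodule k (Fin 5 → k), finrank k F = 2 ∧ ∀ x, x ∈ F ↔ ∀ e ∈ E, x ⬝ᵥ e = 0 := by
  classical
  obtain ⟨B, C, hCB, hBE⟩ := exists_colMatrix_leftInverse E hE
  -- the columns of `B` span `E`
  have hspan : Submodule.span k (Set.range fun a : Fin 3 => fun ν => B ν a) = E := by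
    have hli : LinearIndependent k (fun a : Fin 3 => fun ν => B ν a) := by
      rw [Fintype.linearIndependent_iff]
      intro g hg a
      have h1 : B *ᵥ g = 0 := by
        ext ν
        have := congrFun hg ν
        simpa [Matrix.mulVec, dotProduct, Finset.sum_apply, Pi.smul_apply, mul_comm] using this
      have h2 : C *ᵥ (B *ᵥ g) = g := by rw [Matrix.mulVec_mulVec, hCB, Matrix.one_mulVec]
      rw [h1, Matrix.mulVec_zero] at h2
      exact (congrFun h2 a).symm
    refine Submodule.eq_of_le_of_finrank_eq ?_ ?_
    · rw [Submodule.span_le, Set.range_subset_iff]; exact hBE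
    · rw [finrank_span_eq_card hli, Fintype.card_fin, hE]
  let φ : (Fin 5 → k) →ₗ[k] (Fin 3 → k) := Matrix.toLin' Bᵀ
  refine ⟨LinearMap.ker φ, ?_, fun x => ?_⟩
  · have hsurj : LinearMap.range φ = ⊤ := by
      rw [LinearMap.range_eq_top]
      intro y
      refine ⟨Cᵀ *ᵥ y, ?_⟩
      show Bᵀ *ᵥ (Cᵀ *ᵥ y) = y
      rw [Matrix.mulVec_mulVec, ← Matrix.transpose_mul, hCB, Matrix.transpose_one,
        Matrix.one_mulVec]
    have h := LinearMap.finrank_range_add_finrank_ker φ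
    rw [hsurj, finrank_top, Module.finrank_fin_fun, Module.finrank_fin_fun] at h
    omega
  · rw [LinearMap.mem_ker]
    constructor
    · intro hx e he
      rw [← hspan] at he
      refine Submodule.span_induction (fun e' he' => ?_) ?_ (fun e₁ e₂ _ _ h₁ h₂ => ?_)
        (fun a e' _ h' => ?_) he
      · obtain ⟨a, rfl⟩ := he'
        have := congrFun hx a
        simpa [φ, Matrix.toLin'_apply, Matrix.mulVec, dotProduct, Matrix.transpose_apply,
          mul_comm] using this
      · exact dotProduct_zero x
      · rw [dotProduct_add, h₁, h₂, add_zero]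
      · rw [dotProduct_smul, h', smul_zero]
    · intro h
      ext a
      have := h _ (hBE a)
      simpa [φ, Matrix.toLin'_apply, Matrix.mulVec, dotProduct, Matrix.transpose_apply,
        mul_comm] using this

variable {ι : Type*} [Fintype ι]

/-- **The gauge applied to a computation** (`⟨2,2,5⟩`, two saturated column planes). If the outputs
of `R₁` kill a 3-space `E₁` and those of `R₂` kill a 3-space `E₂` (as
`card_vanishing_col_eq_two_mul_sub` + `mulVec_eq_zero_of_orth_iff` deliver at `r = 17`), then for
some `A A' = A' A = 1` the computation `(f_i, g_i(· A), W_i A')` — SAME X-forms — has the outputs of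
`R₁` supported on columns `0,1` (`F′₁ = ⟨e₀,e₁⟩`) and those of `R₂` supported on columns `0,1`
('same'), `0,2` ('line') or `2,3` ('zero'). (By `false_of_two_saturated_col_planes_sameF` the 'same'
alternative cannot occur for disjoint saturated planes; it is listed because this theorem does not
assume saturation.) -/
theorem exists_gauge_normal_form_225 (β : BilinComp (mulBilin k 2 2 5) ι)
    (E₁ E₂ : Submodule k (Fin 5 → k)) (hE₁ : finrank k E₁ = 3) (hE₂ : finrank k E₂ = 3)
    (R₁ R₂ : Finset ι) (hR₁ : ∀ i ∈ R₁, ∀ v ∈ E₁, β.w i *ᵥ v = 0)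
    (hR₂ : ∀ i ∈ R₂, ∀ v ∈ E₂, β.w i *ᵥ v = 0) :
    ∃ (A A' : Matrix (Fin 5) (Fin 5) k) (β' : BilinComp (mulBilin k 2 2 5) ι),
      A * A' = 1 ∧ A' * A = 1 ∧
      (∀ i, β'.f i = β.f i) ∧ (∀ i Y, β'.g i Y = β.g i (Y * A)) ∧ (∀ i, β'.w i = β.w i * A') ∧
      (∀ i ∈ R₁, ∀ κ, β'.w i κ 2 = 0 ∧ β'.w i κ 3 = 0 ∧ β'.w i κ 4 = 0) ∧
      ((∀ i ∈ R₂, ∀ κ, β'.w i κ 2 = 0 ∧ β'.w i κ 3 = 0 ∧ β'.w i κ 4 = 0) ∨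
       (∀ i ∈ R₂, ∀ κ, β'.w i κ 1 = 0 ∧ β'.w i κ 3 = 0 ∧ β'.w i κ 4 = 0) ∨
       (∀ i ∈ R₂, ∀ κ, β'.w i κ 0 = 0 ∧ β'.w i κ 1 = 0 ∧ β'.w i κ 4 = 0)) := by
  obtain ⟨F₁, hF₁, hmem₁⟩ := exists_dotOrthogonal_fin5 E₁ hE₁
  obtain ⟨F₂, hF₂, hmem₂⟩ := exists_dotOrthogonal_fin5 E₂ hE₂
  -- rows of the outputs lie in `F′_j = E_j^⊥`
  have hrow : ∀ (R : Finset ι) (E F : Submodule k (Fin 5 → k)),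
      (∀ x, x ∈ F ↔ ∀ e ∈ E, x ⬝ᵥ e = 0) → (∀ i ∈ R, ∀ v ∈ E, β.w i *ᵥ v = 0) →
      ∀ i ∈ R, ∀ κ, β.w i κ ∈ F := by
    intro R E F hmem hR i hi κ
    rw [hmem]
    intro e he
    have := congrFun (hR i hi e he) κ
    simpa [Matrix.mulVec] using this
  obtain ⟨A, A', hAA', hA'A, hU₁, hU₂⟩ := exists_gauge_pair_fin5 F₁ F₂ hF₁ hF₂
  obtain ⟨β', hf, hg, hw⟩ := exists_colTransform β A A' hAA'
  have hcoord : ∀ i κ j, β'.w i κ j = (β.w i κ ᵥ* A') j := fun i κ j => by rw [hw]; rfl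
  refine ⟨A, A', β', hAA', hA'A, hf, hg, hw, fun i hi κ => ?_, ?_⟩
  · simp only [hcoord]
    exact hU₁ _ (hrow R₁ E₁ F₁ hmem₁ hR₁ i hi κ)
  · rcases hU₂ with h | h | h
    · exact Or.inl fun i hi κ => by simp only [hcoord]; exact h _ (hrow R₂ E₂ F₂ hmem₂ hR₂ i hi κ)
    · exact Or.inr (Or.inl fun i hi κ => by
        simp only [hcoord]; exact h _ (hrow R₂ E₂ F₂ hmem₂ hR₂ i hi κ))
    · exact Or.inr (Or.inr fun i hi κ => by
        simp only [hcoord]; exact h _ (hrow R₂ E₂ F₂ hmem₂ hR₂ i hi κ))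

end Summit.MatrixMultiplication.OmegaCensus.RankOnePlaneCapGeneral
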